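import Summits.HodgeConjecture.HodgeConjecture.Theorems.EquidimHeckeQuotientClass
import Literature.AlgebraicGeometry.ModuliOfAbelianVarieties.SiegelHeckeQuotientSectionKernel
import HarnessLib

/-!
# Socket (B) «the isogeny-quotient map» of the Hecke-link line, assembled from a quotient FAMILY (the wrapper over ★
# `hcompat_of_pointwiseHeckeQuotient_of_sectionKernel` and ★ `heckeQuotient_class_eq`)

Cell hodgecm-mathlib (D-0151), crux `hDel` / E-road line `EquidimOfF`, Hecke-link sub-line (card v1.1), socket (B) (B-p14 (g14)).
THEOREMS ONLY; no definition, no named fact, no instance, no `sorry`.  HC_CM is proved only modulo the printed citations until rung 0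
closes.

`SocketQuotientMap` (B-p01 (g13) probe v4 :1117, v5 with the `hthick` binder) asks, at a Hecke-linked point `s′` of a piece `ι′ : S″ ⟶
𝓜′_ℂ`, for a CONTINUOUS `Φ : S″(ℂ) → 𝓜_ℂ(ℂ)` with `Φ s′ = x`, an open `θ`, a principal `r`, and the period-compatibility clause.  This
file produces exactly that ∃-body from EXPLICIT link data `(θ, γ, r, r′, ν)` (what the glue unpacks from ★ `HeckeLinked` plus B3+'s
integer `ν`), ONE `(Z, r′)`-admissible pair of class `ι′ s′` (from `IsThickAtWith`), and a QUOTIENT FAMILY: an algebraic map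
`qℂ : S″ ⟶ 𝓜_ℂ` whose value at every complex point `s` is the class of a pointwise Hecke quotient of a triple of class `ι′ s` (the
per-point export of H2/H4-ALG in the section-kernel shape of ★ p745395).  `Φ := qℂ(ℂ)` is continuous (★ `AlgPoints.continuous_map`),
period-compatible (★ `hcompat_of_pointwiseHeckeQuotient_of_sectionKernel`) and `Φ s′ = x` (★ `heckeQuotient_class_eq`).

* `exists_periodCompatibleMap_of_quotientFamily` — the ∃-body of `SocketQuotientMap`.
-/

set_option autoImplicit false

noncomputable section

open CategoryTheory CategoryTheory.Limits AlgebraicGeometry Matrix Topology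
open Literature.AlgebraicGeometry.Motives (SchemeOver ComplexPoints AlgPoints specOver AbelianVariety CartierDivisor)
open Literature.AlgebraicGeometry.AbelianSchemes (PolarizedAbelianSchemeWithLevel AbelianSchemeOver)
open Literature.NumberTheory.Automorphic (siegelUpperHalfSpace)
open Literature.NumberTheory.Adeles
open Literature.AlgebraicGeometry.ModuliOfAbelianVarieties

namespace Summit.HodgeConjecture.CorCM.HypDel.EquidimHeckeQuotient

open SiegelModuli
open scoped MonObj

/-- **SOCKET (B) FROM A QUOTIENT FAMILY**: given explicit link data at `(ι′ s′, x)` — an open `θ` with `J(θZ) = γ_ℝ J(Z) γ_ℝ⁻¹`,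
`r ∈ K_δ(1)`, ★ `QuotientAdapted δ δ N N′ r r′ γ`, the integer multiplier `ν` with `ᵗγE_δγ = νE_δ`, the analytic cut «every
`(Z, r′)`-admissible triple of class `ι′ s′` has a `(θZ, r)`-admissible partner of class `x`» — one `(Z, r′)`-admissible pair of class
`ι′ s′`, and an algebraic `qℂ : S″ ⟶ 𝓜_ℂ` with a pointwise Hecke quotient of class `qℂ(s)` at every complex point (section-kernel
shape), the ∃-body of `SocketQuotientMap` holds with `Φ := qℂ(ℂ)`.
[cite: Milne2005ShimuraVarieties, §5 p. 58 (Def. 5.14) and §6 Thm. 6.11 p. 74 and p. 75]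
[cite: MumfordFogartyKirwan1994, Ch. 7 §3 (p. 139)] -/
theorem exists_periodCompatibleMap_of_quotientFamily {g N N' d : ℕ} {δ : Fin g → ℕ} (hδ : IsPolarizationType δ)
    (hg : 0 < g) (hN : 3 ≤ N) (hd : N' = N * d) (hd0 : d ≠ 0)
    (𝓜 : SiegelFineModuliScheme g N δ) (𝓜' : SiegelFineModuliScheme g N' δ) [IsLocallyNoetherian (specOver ℚ ℂ).left]
    {S'' : SchemeOver ℂ} (ι' : S'' ⟶ (Literature.AlgebraicGeometry.Motives.baseChange ℚ ℂ).obj 𝓜'.M)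
    (s' : ComplexPoints S'') (x : ComplexPoints ((Literature.AlgebraicGeometry.Motives.baseChange ℚ ℂ).obj 𝓜.M))
    (r r' : gspFinAdelic δ) (hr : r ∈ principalLevelSubgroup δ 1) (γq : GL (Fin g ⊕ Fin g) ℚ) (ν : ℕ)
    (θ : siegelUpperHalfSpace g → siegelUpperHalfSpace g) (hθo : IsOpenMap θ)
    (hθ : ∀ Z : siegelUpperHalfSpace g, jOfSiegel δ ((θ Z : siegelUpperHalfSpace g) : Matrix (Fin g) (Fin g) ℂ) =
      conjJ (Matrix.GeneralLinearGroup.map (algebraMap ℚ ℝ) γq) (jOfSiegel δ (Z : Matrix (Fin g) (Fin g) ℂ)))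
    (hQA : QuotientAdapted δ δ N N' r r' γq)
    (hQA3 : (γq : Matrix (Fin g ⊕ Fin g) (Fin g ⊕ Fin g) ℚ)ᵀ * typeFormOver δ ℚ *
      (γq : Matrix (Fin g ⊕ Fin g) (Fin g ⊕ Fin g) ℚ) = (ν : ℚ) • typeFormOver δ ℚ)
    (hcut : ∀ (Z : siegelUpperHalfSpace g) (P' : PolarizedAbelianSchemeWithLevel g N' δ (specOver ℚ ℂ).left),
      IsAdmissibleAt hδ r' Z.1 Z.2 P' →
      AlgPoints.baseChangeEquiv (algebraMap ℚ ℂ) 𝓜'.M (𝓜'.classifyingMap (specOver ℚ ℂ) P') = AlgPoints.map (L := ℂ) ι' s' →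
      ∃ P : PolarizedAbelianSchemeWithLevel g N δ (specOver ℚ ℂ).left,
        IsAdmissibleAt hδ r (θ Z).1 (θ Z).2 P ∧
        AlgPoints.baseChangeEquiv (algebraMap ℚ ℂ) 𝓜.M (𝓜.classifyingMap (specOver ℚ ℂ) P) = x)
    (hex : ∃ (Z : siegelUpperHalfSpace g) (P' : PolarizedAbelianSchemeWithLevel g N' δ (specOver ℚ ℂ).left),
      IsAdmissibleAt hδ r' Z.1 Z.2 P' ∧
      AlgPoints.baseChangeEquiv (algebraMap ℚ ℂ) 𝓜'.M (𝓜'.classifyingMap (specOver ℚ ℂ) P') = AlgPoints.map (L := ℂ) ι' s')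
    (hfam : ∃ qℂ : S'' ⟶ (Literature.AlgebraicGeometry.Motives.baseChange ℚ ℂ).obj 𝓜.M, ∀ s : ComplexPoints S'',
      ∃ (U : PolarizedAbelianSchemeWithLevel g N' δ (specOver ℚ ℂ).left)
        (_ : AlgPoints.baseChangeEquiv (algebraMap ℚ ℂ) 𝓜'.M (𝓜'.classifyingMap (specOver ℚ ℂ) U) =
          AlgPoints.map (L := ℂ) ι' s)
        (Q : PolarizedAbelianSchemeWithLevel g N δ (specOver ℚ ℂ).left)
        (ψ : (U.A.fibre (𝟙 (Spec (CommRingCat.of ℂ)))).toAbelianVariety ⟶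
          (Q.A.fibre (𝟙 (Spec (CommRingCat.of ℂ)))).toAbelianVariety)
        (_ : IsDominant ψ.hom.hom.hom.left),
        (Q.A.fibre (𝟙 (Spec (CommRingCat.of ℂ)))).toAbelianVariety.dim = g ∧
        (∀ P : (U.A.fibre (𝟙 (Spec (CommRingCat.of ℂ)))).toAbelianVariety.Points ℂ,
          AlgPoints.map ψ.hom.hom.hom P = 1 ↔
            ∃ c : Fin g ⊕ Fin g → ZMod N',
              (∃ v : Fin g ⊕ Fin g → ℚ,
                (γq : Matrix (Fin g ⊕ Fin g) (Fin g ⊕ Fin g) ℚ) *ᵥ v ∈ latticeOfGL (r : GL (Fin g ⊕ Fin g) finAdeleQ) ∧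
                AdelicCongr ((r'⁻¹ : gspFinAdelic δ) : GL (Fin g ⊕ Fin g) finAdeleQ) 1 v
                  (fun i => ((c i).val : ℚ) / N')) ∧
              P = U.A.restrictPt (𝟙 (Spec (CommRingCat.of ℂ))) (U.level.section_ c)) ∧
        Function.Surjective (AlgPoints.map (L := ℂ) ψ.hom.hom.hom :
          (U.A.fibre (𝟙 (Spec (CommRingCat.of ℂ)))).toAbelianVariety.Points ℂ →
            (Q.A.fibre (𝟙 (Spec (CommRingCat.of ℂ)))).toAbelianVariety.Points ℂ) ∧
        (∀ i : Fin g ⊕ Fin g,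
          Q.A.restrictPt (𝟙 (Spec (CommRingCat.of ℂ))) (Q.level.σ i) =
            AlgPoints.map ψ.hom.hom.hom (U.A.restrictPt (𝟙 (Spec (CommRingCat.of ℂ))) (U.level.σ i ^ d))) ∧
        (∀ (Θ' : CartierDivisor (U.A.fibre (𝟙 (Spec (CommRingCat.of ℂ)))).toAbelianVariety.X.left)
          (Θ : CartierDivisor (Q.A.fibre (𝟙 (Spec (CommRingCat.of ℂ)))).toAbelianVariety.X.left),
          U.A.IsLambdaOfAt (𝟙 (Spec (CommRingCat.of ℂ))) U.D U.pol.lam Θ' →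
          Q.A.IsLambdaOfAt (𝟙 (Spec (CommRingCat.of ℂ))) Q.D Q.pol.lam Θ →
          ∀ y : (U.A.fibre (𝟙 (Spec (CommRingCat.of ℂ)))).toAbelianVariety.Points ℂ,
            (((Θ.pullback ψ.hom.hom.hom.left + -(ν • Θ')).pullback
              ((U.A.fibre (𝟙 (Spec (CommRingCat.of ℂ)))).toAbelianVariety.translation y).left).LinEquiv
              (Θ.pullback ψ.hom.hom.hom.left + -(ν • Θ')))) ∧
        AlgPoints.baseChangeEquiv (algebraMap ℚ ℂ) 𝓜.M (𝓜.classifyingMap (specOver ℚ ℂ) Q) = AlgPoints.map (L := ℂ) qℂ s) :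
    ∃ (Φ : ComplexPoints S'' → ComplexPoints ((Literature.AlgebraicGeometry.Motives.baseChange ℚ ℂ).obj 𝓜.M))
      (_ : Continuous Φ) (_ : Φ s' = x)
      (θ : siegelUpperHalfSpace g → siegelUpperHalfSpace g) (_ : IsOpenMap θ)
      (r : gspFinAdelic δ) (_ : r ∈ principalLevelSubgroup δ 1),
      ∀ (s : ComplexPoints S'') (Z : siegelUpperHalfSpace g)
        (P' : PolarizedAbelianSchemeWithLevel g N' δ (specOver ℚ ℂ).left),
        IsAdmissibleAt hδ r' Z.1 Z.2 P' →
        AlgPoints.baseChangeEquiv (algebraMap ℚ ℂ) 𝓜'.M (𝓜'.classifyingMap (specOver ℚ ℂ) P') = AlgPoints.map (L := ℂ) ι' s →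
        ∃ P : PolarizedAbelianSchemeWithLevel g N δ (specOver ℚ ℂ).left,
          IsAdmissibleAt hδ r (θ Z).1 (θ Z).2 P ∧
          AlgPoints.baseChangeEquiv (algebraMap ℚ ℂ) 𝓜.M (𝓜.classifyingMap (specOver ℚ ℂ) P) = Φ s := by
  obtain ⟨qℂ, hq⟩ := hfam
  have hN1 : 1 < N := by omega
  have hcompat := hcompat_of_pointwiseHeckeQuotient_of_sectionKernel hδ hg hN1 hd hd0 𝓜 𝓜' ι' (AlgPoints.map (L := ℂ) qℂ)
    r r' hr γq ν θ hθ hQA hQA3 hq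
  have hx : AlgPoints.map (L := ℂ) qℂ s' = x :=
    heckeQuotient_class_eq hg hδ hN 𝓜 𝓜' r hr r' θ (AlgPoints.map (L := ℂ) ι' s') x (AlgPoints.map (L := ℂ) qℂ s') hcut
      (hcompat s') hex
  exact ⟨AlgPoints.map (L := ℂ) qℂ, Literature.AlgebraicGeometry.Motives.AlgPoints.continuous_map qℂ, hx, θ, hθo, r, hr, hcompat⟩

end Summit.HodgeConjecture.CorCM.HypDel.EquidimHeckeQuotient

end
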